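import Literature.Analysis.FluidPDE.AxisymQuotientBounds
import HarnessLib

/-!
# The Hou–Li quotients away from the axis: `|ω^θ/r|, |ωʳ/r| ≤ |ω|/r`, `|∇(vʳ/r)| ≤ 3|v|/r² + |Dv|/r`,
# and the outer-region integrals `∫_{r > δ}`

Analysis/FluidPDE support file (calculus and elementary integration; theorems only, no
definitions, no named facts) on the discharge path of the named fact
`Literature.Analysis.FluidPDE.LeiZhang2017_logModulus_regularity` (Lei–Zhang 2017, Cor. 1.3).
In the proof of Thm. 1.2 (§3, arXiv p. 8) the Form Boundedness Condition produces outer-region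
terms `C∫_{r ≥ r₀}(|J|² + |Ω|²)` and `C₀∫_{r ≥ r₀}|∇(vʳ/r)|²`, which are absorbed into
"`C‖ω‖²_{L²}`" and "`C∫|∇v|²`" ((3.5)–(3.6): "Using Lemma 2.1 and the identity
`∇(vʳ/r) = ∇vʳ/r − e_r vʳ/r²`"). This file proves the pointwise bounds behind these absorptions
and the corresponding integral inequalities:

* `abs_swirl_le_cylRadius_mul_norm'` — `|x₀w₁ − x₁w₀| ≤ r ‖w‖` for any vector `w`
  (no symmetry needed), and `abs_horizontal_inner_le_cylRadius_mul_norm` — `|x₀w₀ + x₁w₁| ≤ r‖w‖`;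
* `IsAxisymmetric.abs_angVortQuot_le_norm_curl_div` — `|ω^θ/r|(x) ≤ ‖ω(x)‖/r` off the axis,
  `IsAxisymmetric.abs_radVelQuot_curl_le_norm_curl_div` — `|ωʳ/r|(x) ≤ ‖ω(x)‖/r`;
* `IsAxisymmetric.norm_fderiv_radVelQuot_le` — `‖D(vʳ/r)(x)‖ ≤ 3‖v(x)‖/r² + ‖Dv(x)‖/r` off the
  axis (differentiate `ρ · (vʳ/r) = x₀v₀ + x₁v₁`);
* outer integrals: `setIntegral_sq_le_of_abs_le_div` (generic: `|Q| ≤ ‖ω‖/r` off the axis gives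
  `∫_{r>δ} Q² ≤ δ⁻² ∫ ‖ω‖²`), and `IsAxisymmetric.setIntegral_norm_fderiv_radVelQuot_sq_le` —
  `∫_{r>δ} ‖D(vʳ/r)‖² ≤ 18δ⁻⁴ ∫‖v‖² + 2δ⁻² ∫‖Dv‖²`; `norm_curl_le_norm_curlCLM_mul` —
  `‖curl v(x)‖ ≤ ‖curlCLM‖ ‖Dv(x)‖`.

## Mathlib / tree search

Tree: `IsAxisymmetric.cylRadius_sq_mul_angVortQuot / _radVelQuot` (`AxisymHouLiVariables`),
`fderiv_rho_apply`, `contDiff_horizSq` (`AxisymQuotientEquations`), `fderiv_horizontal_inner_apply`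
(`AxisymQuotientEquationsJ` — restated inline to keep imports light), `curl_eq_curlCLM`.
`norm_curl_le` exists in `TaoEnstrophyLocalisation` (heavy import; restated).

## References

* Z. Lei, Q. S. Zhang, Pacific J. Math. 289 (2017) 169–187, arXiv:1505.02628, §3 (3.4)–(3.6),
  p. 8. [`LeiZhang2017`]
-/

noncomputable section

open MeasureTheory Set Function Filter Topology InnerProductSpace WithLp
open scoped RealInnerProductSpace ContDiff ENNReal

namespace Literature.Analysis.FluidPDE

/-! ### Pointwise bounds off the axis -/

section Pointwise

variable {u : EuclideanSpace ℝ (Fin 3) → EuclideanSpace ℝ (Fin 3)} {x : EuclideanSpace ℝ (Fin 3)}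

/-- `‖w‖² = w₀² + w₁² + w₂²` on `ℝ³`. [folklore] -/
private theorem norm_sq_eq_three (w : EuclideanSpace ℝ (Fin 3)) : ‖w‖ ^ 2 = w 0 ^ 2 + w 1 ^ 2 + w 2 ^ 2 := by
  rw [EuclideanSpace.norm_eq, Real.sq_sqrt (by positivity), Fin.sum_univ_three]
  simp only [Real.norm_eq_abs, sq_abs]

/-- `|x₀w₁ − x₁w₀| ≤ r ‖w‖` for every `w ∈ ℝ³`. [folklore] -/
theorem abs_swirl_le_cylRadius_mul_norm' (x w : EuclideanSpace ℝ (Fin 3)) :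
    |x 0 * w 1 - x 1 * w 0| ≤ cylRadius x * ‖w‖ := by
  refine abs_le_of_sq_le_sq ?_ (mul_nonneg (cylRadius_nonneg x) (norm_nonneg w))
  rw [mul_pow, cylRadius_sq, norm_sq_eq_three]
  nlinarith [sq_nonneg (x 0 * w 0 + x 1 * w 1), sq_nonneg (w 2), sq_nonneg (x 0), sq_nonneg (x 1),
    mul_nonneg (add_nonneg (sq_nonneg (x 0)) (sq_nonneg (x 1))) (sq_nonneg (w 2))]

/-- `|x₀w₀ + x₁w₁| ≤ r ‖w‖` for every `w ∈ ℝ³`. [folklore] -/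
private theorem abs_horizontal_inner_le_cylRadius_mul_norm (x w : EuclideanSpace ℝ (Fin 3)) :
    |x 0 * w 0 + x 1 * w 1| ≤ cylRadius x * ‖w‖ := by
  refine abs_le_of_sq_le_sq ?_ (mul_nonneg (cylRadius_nonneg x) (norm_nonneg w))
  rw [mul_pow, cylRadius_sq, norm_sq_eq_three]
  nlinarith [sq_nonneg (x 0 * w 1 - x 1 * w 0), sq_nonneg (w 2), sq_nonneg (x 0), sq_nonneg (x 1),
    mul_nonneg (add_nonneg (sq_nonneg (x 0)) (sq_nonneg (x 1))) (sq_nonneg (w 2))]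

/-- **`|ω^θ/r|(x) ≤ ‖ω(x)‖/r` off the axis**, for an axisymmetric `u ∈ C³` (`ω = curl u`;
`r² · (ω^θ/r) = x₀ω₁ − x₁ω₀`). [folklore] -/
theorem IsAxisymmetric.abs_angVortQuot_le_norm_curl_div (hax : IsAxisymmetric u) (hu : ContDiff ℝ 3 u)
    (hx : cylRadius x ≠ 0) : |angVortQuot u x| ≤ ‖FluidPDE.curl u x‖ / cylRadius x := by
  have hr : 0 < cylRadius x := lt_of_le_of_ne (cylRadius_nonneg x) (Ne.symm hx)
  have h := hax.cylRadius_sq_mul_angVortQuot hu x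
  have hb := abs_swirl_le_cylRadius_mul_norm' x (FluidPDE.curl u x)
  rw [le_div_iff₀ hr]
  have key : cylRadius x * (cylRadius x * |angVortQuot u x|) ≤ cylRadius x * ‖FluidPDE.curl u x‖ := by
    calc cylRadius x * (cylRadius x * |angVortQuot u x|) = |cylRadius x ^ 2 * angVortQuot u x| := by
          rw [abs_mul, abs_of_pos (pow_pos hr 2)]; ring
      _ = |x 0 * FluidPDE.curl u x 1 - x 1 * FluidPDE.curl u x 0| := by rw [h]; rfl
      _ ≤ cylRadius x * ‖FluidPDE.curl u x‖ := hb
  have h2 := le_of_mul_le_mul_left key hr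
  linarith [mul_comm (|angVortQuot u x|) (cylRadius x)]

/-- **`|ωʳ/r|(x) ≤ ‖ω(x)‖/r` off the axis**, for an axisymmetric `u ∈ C³`
(`r² · (ωʳ/r) = x₀ω₀ + x₁ω₁`). [folklore] -/
theorem IsAxisymmetric.abs_radVelQuot_curl_le_norm_curl_div (hax : IsAxisymmetric u)
    (hu : ContDiff ℝ 3 u) (hx : cylRadius x ≠ 0) :
    |radVelQuot (FluidPDE.curl u) x| ≤ ‖FluidPDE.curl u x‖ / cylRadius x := by
  have hr : 0 < cylRadius x := lt_of_le_of_ne (cylRadius_nonneg x) (Ne.symm hx)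
  have hω2 : ContDiff ℝ 2 (FluidPDE.curl u) := contDiff_curl_of_succ (n := 2) (by exact_mod_cast hu)
  have haxω : IsAxisymmetric (FluidPDE.curl u) := hax.curl (hu.differentiable (by norm_num))
  have h := haxω.cylRadius_sq_mul_radVelQuot hω2 x
  have hb := abs_horizontal_inner_le_cylRadius_mul_norm x (FluidPDE.curl u x)
  rw [le_div_iff₀ hr]
  have key : cylRadius x * (cylRadius x * |radVelQuot (FluidPDE.curl u) x|) ≤
      cylRadius x * ‖FluidPDE.curl u x‖ := by
    calc cylRadius x * (cylRadius x * |radVelQuot (FluidPDE.curl u) x|) =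
        |cylRadius x ^ 2 * radVelQuot (FluidPDE.curl u) x| := by
          rw [abs_mul, abs_of_pos (pow_pos hr 2)]; ring
      _ = |x 0 * FluidPDE.curl u x 0 + x 1 * FluidPDE.curl u x 1| := by rw [h]
      _ ≤ cylRadius x * ‖FluidPDE.curl u x‖ := hb
  have h2 := le_of_mul_le_mul_left key hr
  linarith [mul_comm (|radVelQuot (FluidPDE.curl u) x|) (cylRadius x)]

/-- `|uʳ/r|(x) ≤ ‖u(x)‖/r` off the axis, for an axisymmetric `u ∈ C²`. [folklore] -/
theorem IsAxisymmetric.abs_radVelQuot_le_norm_div (hax : IsAxisymmetric u) (hu : ContDiff ℝ 2 u)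
    (hx : cylRadius x ≠ 0) : |radVelQuot u x| ≤ ‖u x‖ / cylRadius x := by
  have hr : 0 < cylRadius x := lt_of_le_of_ne (cylRadius_nonneg x) (Ne.symm hx)
  have h := hax.cylRadius_sq_mul_radVelQuot hu x
  have hb := abs_horizontal_inner_le_cylRadius_mul_norm x (u x)
  rw [le_div_iff₀ hr]
  have key : cylRadius x * (cylRadius x * |radVelQuot u x|) ≤ cylRadius x * ‖u x‖ := by
    calc cylRadius x * (cylRadius x * |radVelQuot u x|) = |cylRadius x ^ 2 * radVelQuot u x| := by
          rw [abs_mul, abs_of_pos (pow_pos hr 2)]; ring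
      _ = |x 0 * u x 0 + x 1 * u x 1| := by rw [h]
      _ ≤ cylRadius x * ‖u x‖ := hb
  have h2 := le_of_mul_le_mul_left key hr
  linarith [mul_comm (|radVelQuot u x|) (cylRadius x)]

/-- `D⟪x_h, u⟫(x) c = c₀u₀ + c₁u₁ + (x₀ (Du c)₀ + x₁ (Du c)₁)` (restated from
`AxisymQuotientEquationsJ`). [folklore] -/
private theorem fderiv_horizontal_inner_apply' (hd : DifferentiableAt ℝ u x) (c : EuclideanSpace ℝ (Fin 3)) :
    fderiv ℝ (fun y => y 0 * u y 0 + y 1 * u y 1) x c =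
      c 0 * u x 0 + c 1 * u x 1 + (x 0 * fderiv ℝ u x c 0 + x 1 * fderiv ℝ u x c 1) := by
  have hc : ∀ i : Fin 3, DifferentiableAt ℝ (fun y : EuclideanSpace ℝ (Fin 3) => y i) x := fun i =>
    (EuclideanSpace.proj (𝕜 := ℝ) i).differentiableAt
  have hwi : ∀ i : Fin 3, DifferentiableAt ℝ (fun y => u y i) x := fun i =>
    (EuclideanSpace.proj (𝕜 := ℝ) i).differentiableAt.comp x hd
  have hcf : ∀ (i : Fin 3) (h : EuclideanSpace ℝ (Fin 3)),
      fderiv ℝ (fun y : EuclideanSpace ℝ (Fin 3) => y i) x h = h i := fun i h => by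
    have : (fun y : EuclideanSpace ℝ (Fin 3) => y i) = ⇑(EuclideanSpace.proj (𝕜 := ℝ) i) := rfl
    rw [this, ContinuousLinearMap.fderiv]; rfl
  rw [fderiv_fun_add ((hc 0).fun_mul (hwi 0)) ((hc 1).fun_mul (hwi 1)), fderiv_fun_mul (hc 0) (hwi 0),
    fderiv_fun_mul (hc 1) (hwi 1)]
  simp only [_root_.add_apply, _root_.FunLike.coe_smul, Pi.smul_apply, smul_eq_mul, hcf,
    fderiv_apply_coord_vec3 hd]
  ring

/-- **`‖D(uʳ/r)(x)‖ ≤ 3‖u(x)‖/r² + ‖Du(x)‖/r` off the axis**, for an axisymmetric `u ∈ C²`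
(differentiate `(x₀² + x₁²) · radVelQuot u = x₀u₀ + x₁u₁`: `D(uʳ/r)[h] = (D⟪x_h,u⟫[h] −
2⟪x_h,h_h⟫ (uʳ/r))/r²`, with `|D⟪x_h,u⟫[h]| ≤ ‖h‖(‖u‖ + r‖Du‖)`, `|uʳ/r| ≤ ‖u‖/r`). This is
Lei–Zhang's "`∇(vʳ/r) = ∇vʳ/r − e_r vʳ/r²`". [cite: LeiZhang2017, §3 (identity before (3.5), arXiv p. 8)] -/
theorem IsAxisymmetric.norm_fderiv_radVelQuot_le (hax : IsAxisymmetric u) (hu : ContDiff ℝ 3 u)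
    (hx : cylRadius x ≠ 0) :
    ‖fderiv ℝ (radVelQuot u) x‖ ≤ 3 * ‖u x‖ / cylRadius x ^ 2 + ‖fderiv ℝ u x‖ / cylRadius x := by
  have hr : 0 < cylRadius x := lt_of_le_of_ne (cylRadius_nonneg x) (Ne.symm hx)
  have hu2 : ContDiff ℝ 2 u := hu.of_le (by norm_num)
  have hud : Differentiable ℝ u := hu.differentiable (by norm_num)
  have hW1 : ContDiff ℝ 1 (radVelQuot u) := contDiff_radVelQuot (n := 1) (by exact_mod_cast hu)
  have hWd : Differentiable ℝ (radVelQuot u) := hW1.differentiable one_ne_zero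
  have hρd : Differentiable ℝ (fun y : EuclideanSpace ℝ (Fin 3) => y 0 ^ 2 + y 1 ^ 2) :=
    contDiff_horizSq.differentiable two_ne_zero
  -- `ρ W = ⟪x_h, u⟫` as functions
  have hprod : (fun y : EuclideanSpace ℝ (Fin 3) => (y 0 ^ 2 + y 1 ^ 2) * radVelQuot u y) =
      fun y => y 0 * u y 0 + y 1 * u y 1 := by
    funext y
    rw [← cylRadius_sq, hax.cylRadius_sq_mul_radVelQuot hu2 y]
  -- the derivative identity applied to `h`
  have hid : ∀ h : EuclideanSpace ℝ (Fin 3), 2 * (x 0 * h 0 + x 1 * h 1) * radVelQuot u x +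
      cylRadius x ^ 2 * fderiv ℝ (radVelQuot u) x h =
      h 0 * u x 0 + h 1 * u x 1 + (x 0 * fderiv ℝ u x h 0 + x 1 * fderiv ℝ u x h 1) := by
    intro h
    have e := congrArg (fun f : EuclideanSpace ℝ (Fin 3) → ℝ => fderiv ℝ f x h) hprod
    simp only at e
    rw [fderiv_fun_mul (hρd x) (hWd x), fderiv_horizontal_inner_apply' (hud x)] at e
    simp only [_root_.add_apply, _root_.FunLike.coe_smul, Pi.smul_apply, smul_eq_mul,
      fderiv_rho_apply] at e
    rw [cylRadius_sq]
    linarith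
  -- bound `‖D W x h‖` for each `h`
  have hWb : |radVelQuot u x| ≤ ‖u x‖ / cylRadius x := hax.abs_radVelQuot_le_norm_div hu2 hx
  have hbound : ∀ h : EuclideanSpace ℝ (Fin 3), ‖fderiv ℝ (radVelQuot u) x h‖ ≤
      (3 * ‖u x‖ / cylRadius x ^ 2 + ‖fderiv ℝ u x‖ / cylRadius x) * ‖h‖ := by
    intro h
    have hh : |x 0 * h 0 + x 1 * h 1| ≤ cylRadius x * ‖h‖ := abs_horizontal_inner_le_cylRadius_mul_norm x h
    have h1 : |h 0 * u x 0 + h 1 * u x 1| ≤ ‖h‖ * ‖u x‖ := by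
      have := abs_horizontal_inner_le_cylRadius_mul_norm h (u x)
      -- `cylRadius h ≤ ‖h‖`
      have hch : cylRadius h ≤ ‖h‖ := by
        have h3 : cylRadius h ^ 2 ≤ ‖h‖ ^ 2 := by
          rw [cylRadius_sq, norm_sq_eq_three]; nlinarith [sq_nonneg (h 2)]
        exact le_of_sq_le_sq h3 (norm_nonneg _)
      exact this.trans (mul_le_mul_of_nonneg_right hch (norm_nonneg _))
    have h2 : |x 0 * fderiv ℝ u x h 0 + x 1 * fderiv ℝ u x h 1| ≤ cylRadius x * (‖fderiv ℝ u x‖ * ‖h‖) := by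
      have := abs_horizontal_inner_le_cylRadius_mul_norm x (fderiv ℝ u x h)
      exact this.trans (mul_le_mul_of_nonneg_left ((fderiv ℝ u x).le_opNorm h) (cylRadius_nonneg x))
    -- from `hid`: `r² D W h = RHS − 2⟪x_h,h_h⟫ W`
    have e : fderiv ℝ (radVelQuot u) x h = (h 0 * u x 0 + h 1 * u x 1 +
        (x 0 * fderiv ℝ u x h 0 + x 1 * fderiv ℝ u x h 1) -
        2 * (x 0 * h 0 + x 1 * h 1) * radVelQuot u x) / cylRadius x ^ 2 := by
      have := hid h
      field_simp
      linarith
    rw [e, Real.norm_eq_abs, abs_div, abs_of_pos (pow_pos hr 2), div_le_iff₀ (pow_pos hr 2)]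
    have h3 : |2 * (x 0 * h 0 + x 1 * h 1) * radVelQuot u x| ≤ 2 * (cylRadius x * ‖h‖) * (‖u x‖ / cylRadius x) := by
      rw [abs_mul, abs_mul, abs_two]
      gcongr
    have h3' : 2 * (cylRadius x * ‖h‖) * (‖u x‖ / cylRadius x) = 2 * ‖h‖ * ‖u x‖ := by
      field_simp
    rw [h3'] at h3
    calc |h 0 * u x 0 + h 1 * u x 1 + (x 0 * fderiv ℝ u x h 0 + x 1 * fderiv ℝ u x h 1) -
          2 * (x 0 * h 0 + x 1 * h 1) * radVelQuot u x|
        ≤ |h 0 * u x 0 + h 1 * u x 1| + |x 0 * fderiv ℝ u x h 0 + x 1 * fderiv ℝ u x h 1| +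
          |2 * (x 0 * h 0 + x 1 * h 1) * radVelQuot u x| := by
            refine (abs_sub _ _).trans ?_
            gcongr
            exact abs_add_le _ _
      _ ≤ ‖h‖ * ‖u x‖ + cylRadius x * (‖fderiv ℝ u x‖ * ‖h‖) + 2 * ‖h‖ * ‖u x‖ := by gcongr
      _ = (3 * ‖u x‖ / cylRadius x ^ 2 + ‖fderiv ℝ u x‖ / cylRadius x) * ‖h‖ * cylRadius x ^ 2 := by
            field_simp
            ring
  exact ContinuousLinearMap.opNorm_le_bound _ (by positivity) hbound

end Pointwise


/-! ### Outer-region integrals -/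

section Outer

variable {u : EuclideanSpace ℝ (Fin 3) → EuclideanSpace ℝ (Fin 3)}

/-- The outer region `{r > δ}` is measurable. [folklore] -/
theorem measurableSet_lt_cylRadius (δ : ℝ) : MeasurableSet {x : EuclideanSpace ℝ (Fin 3) | δ < cylRadius x} :=
  measurableSet_lt measurable_const continuous_cylRadius.measurable

/-- **Outer integrals of quotients**: if `|Q(x)| ≤ g(x)/r` off the axis, then
`∫_{r > δ} Q² ≤ δ⁻² ∫ g²` (`δ > 0`; `Q²` integrable on the outer region, `g²` integrable).
[folklore] -/
theorem setIntegral_sq_le_of_abs_le_div {Q g : EuclideanSpace ℝ (Fin 3) → ℝ} {δ : ℝ} (hδ : 0 < δ)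
    (hQ : ∀ x, cylRadius x ≠ 0 → |Q x| ≤ g x / cylRadius x)
    (hQi : IntegrableOn (fun x => Q x ^ 2) {x | δ < cylRadius x}) (hgi : Integrable (fun x => g x ^ 2)) :
    ∫ x in {x | δ < cylRadius x}, Q x ^ 2 ≤ δ⁻¹ ^ 2 * ∫ x, g x ^ 2 := by
  have h1 : ∫ x in {x | δ < cylRadius x}, Q x ^ 2 ≤ ∫ x in {x | δ < cylRadius x}, δ⁻¹ ^ 2 * g x ^ 2 := by
    refine setIntegral_mono_on hQi ((hgi.const_mul _).integrableOn) (measurableSet_lt_cylRadius δ)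
      fun x hx => ?_
    have hr : 0 < cylRadius x := hδ.trans hx
    have hb := hQ x hr.ne'
    have h2 : Q x ^ 2 ≤ (g x / cylRadius x) ^ 2 := by
      rw [← sq_abs (Q x)]
      exact pow_le_pow_left₀ (abs_nonneg _) hb 2
    have h3 : (g x / cylRadius x) ^ 2 ≤ δ⁻¹ ^ 2 * g x ^ 2 := by
      rw [div_pow, div_eq_mul_inv, mul_comm, ← inv_pow]
      gcongr
      · exact le_of_lt hx
    exact h2.trans h3
  refine h1.trans ?_
  rw [integral_const_mul]
  exact mul_le_mul_of_nonneg_left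
    (setIntegral_le_integral hgi (Eventually.of_forall fun x => sq_nonneg _)) (by positivity)

/-- **`∫_{r > δ} ‖D(uʳ/r)‖² ≤ 18δ⁻⁴ ∫‖u‖² + 2δ⁻² ∫‖Du‖²`** for an axisymmetric `u ∈ C³` with
`u, Du ∈ L²` and `‖D(uʳ/r)‖²` integrable on the outer region. [cite: LeiZhang2017, §3 (3.5)–(3.6) (arXiv p. 8)] -/
theorem IsAxisymmetric.setIntegral_norm_fderiv_radVelQuot_sq_le (hax : IsAxisymmetric u)
    (hu : ContDiff ℝ 3 u) {δ : ℝ} (hδ : 0 < δ)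
    (hWi : IntegrableOn (fun x => ‖fderiv ℝ (radVelQuot u) x‖ ^ 2) {x | δ < cylRadius x})
    (hu0 : Integrable (fun x => ‖u x‖ ^ 2)) (hu1 : Integrable (fun x => ‖fderiv ℝ u x‖ ^ 2)) :
    ∫ x in {x | δ < cylRadius x}, ‖fderiv ℝ (radVelQuot u) x‖ ^ 2 ≤
      18 / δ ^ 4 * (∫ x, ‖u x‖ ^ 2) + 2 / δ ^ 2 * ∫ x, ‖fderiv ℝ u x‖ ^ 2 := by
  have hmaj : Integrable (fun x => 18 / δ ^ 4 * ‖u x‖ ^ 2 + 2 / δ ^ 2 * ‖fderiv ℝ u x‖ ^ 2) :=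
    (hu0.const_mul _).add (hu1.const_mul _)
  have h1 : ∫ x in {x | δ < cylRadius x}, ‖fderiv ℝ (radVelQuot u) x‖ ^ 2 ≤
      ∫ x in {x | δ < cylRadius x}, (18 / δ ^ 4 * ‖u x‖ ^ 2 + 2 / δ ^ 2 * ‖fderiv ℝ u x‖ ^ 2) := by
    refine setIntegral_mono_on hWi hmaj.integrableOn (measurableSet_lt_cylRadius δ) fun x hx => ?_
    have hr : 0 < cylRadius x := hδ.trans hx
    have hb := hax.norm_fderiv_radVelQuot_le hu hr.ne'
    -- `3‖u‖/r² + ‖Du‖/r ≤ 3‖u‖/δ² + ‖Du‖/δ`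
    have hδr : δ ≤ cylRadius x := le_of_lt hx
    have e1 : 3 * ‖u x‖ / cylRadius x ^ 2 ≤ 3 * ‖u x‖ / δ ^ 2 := by
      apply div_le_div_of_nonneg_left (by positivity) (pow_pos hδ 2)
      exact pow_le_pow_left₀ hδ.le hδr 2
    have e2 : ‖fderiv ℝ u x‖ / cylRadius x ≤ ‖fderiv ℝ u x‖ / δ :=
      div_le_div_of_nonneg_left (norm_nonneg _) hδ hδr
    have hb' : ‖fderiv ℝ (radVelQuot u) x‖ ≤ 3 * ‖u x‖ / δ ^ 2 + ‖fderiv ℝ u x‖ / δ := by linarith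
    have hsq : ‖fderiv ℝ (radVelQuot u) x‖ ^ 2 ≤ (3 * ‖u x‖ / δ ^ 2 + ‖fderiv ℝ u x‖ / δ) ^ 2 :=
      pow_le_pow_left₀ (norm_nonneg _) hb' 2
    refine hsq.trans ?_
    have : (3 * ‖u x‖ / δ ^ 2 + ‖fderiv ℝ u x‖ / δ) ^ 2 ≤
        2 * (3 * ‖u x‖ / δ ^ 2) ^ 2 + 2 * (‖fderiv ℝ u x‖ / δ) ^ 2 := by
      nlinarith [sq_nonneg (3 * ‖u x‖ / δ ^ 2 - ‖fderiv ℝ u x‖ / δ)]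
    refine this.trans (le_of_eq ?_)
    field_simp
    ring
  refine h1.trans ?_
  have h2 := setIntegral_le_integral (s := {x | δ < cylRadius x}) hmaj
    (Eventually.of_forall fun x => by positivity)
  refine h2.trans (le_of_eq ?_)
  rw [integral_add (hu0.const_mul _) (hu1.const_mul _), integral_const_mul, integral_const_mul]

/-- `‖curl v(x)‖ ≤ ‖curlCLM‖ ‖Dv(x)‖`: the tree's `norm_curl_le` (`TaoEnstrophyLocalisation`); the
name is kept as a one-line restatement because `Wei2016EndgameBalances` and
`LeiZhang2017SliceInequality` use it (dedup-00809). [folklore] -/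
theorem norm_curl_le_norm_curlCLM_mul (v : EuclideanSpace ℝ (Fin 3) → EuclideanSpace ℝ (Fin 3))
    (x : EuclideanSpace ℝ (Fin 3)) :
    ‖FluidPDE.curl v x‖ ≤ ‖(curlCLM : (EuclideanSpace ℝ (Fin 3) →L[ℝ] EuclideanSpace ℝ (Fin 3)) →L[ℝ]
      EuclideanSpace ℝ (Fin 3))‖ * ‖fderiv ℝ v x‖ :=
  norm_curl_le v x

/-- **`∫ ‖curl v‖² ≤ ‖curlCLM‖² ∫ ‖Dv‖²`** for `Dv ∈ L²` (and `v ∈ C¹`). [folklore] -/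
theorem integral_norm_curl_sq_le {v : EuclideanSpace ℝ (Fin 3) → EuclideanSpace ℝ (Fin 3)}
    (hv : ContDiff ℝ 1 v) (hv1 : Integrable (fun x => ‖fderiv ℝ v x‖ ^ 2)) :
    Integrable (fun x => ‖FluidPDE.curl v x‖ ^ 2) ∧
    ∫ x, ‖FluidPDE.curl v x‖ ^ 2 ≤ ‖(curlCLM : (EuclideanSpace ℝ (Fin 3) →L[ℝ] EuclideanSpace ℝ (Fin 3)) →L[ℝ]
      EuclideanSpace ℝ (Fin 3))‖ ^ 2 * ∫ x, ‖fderiv ℝ v x‖ ^ 2 := by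
  set c : ℝ := ‖(curlCLM : (EuclideanSpace ℝ (Fin 3) →L[ℝ] EuclideanSpace ℝ (Fin 3)) →L[ℝ]
      EuclideanSpace ℝ (Fin 3))‖ with hc
  have hle : ∀ x, ‖FluidPDE.curl v x‖ ^ 2 ≤ c ^ 2 * ‖fderiv ℝ v x‖ ^ 2 := fun x => by
    rw [← mul_pow]
    exact pow_le_pow_left₀ (norm_nonneg _) (norm_curl_le_norm_curlCLM_mul v x) 2
  have hcont : Continuous fun x => ‖FluidPDE.curl v x‖ ^ 2 := by
    have : Continuous (FluidPDE.curl v) := by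
      rw [curl_eq_curlCLM_comp]
      exact curlCLM.continuous.comp (hv.continuous_fderiv one_ne_zero)
    exact this.norm.pow 2
  have hI : Integrable (fun x => ‖FluidPDE.curl v x‖ ^ 2) :=
    (hv1.const_mul (c ^ 2)).mono' hcont.aestronglyMeasurable (Eventually.of_forall fun x => by
      rw [Real.norm_eq_abs, abs_of_nonneg (sq_nonneg _)]; exact hle x)
  refine ⟨hI, ?_⟩
  rw [← integral_const_mul]
  exact integral_mono hI (hv1.const_mul _) hle

end Outer

end Literature.Analysis.FluidPDE
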